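import Literature.IUT.HodgeArakelov.ThetaGauLinks
import Mathlib.CategoryTheory.Groupoid
import Mathlib.CategoryTheory.SingleObj
import Mathlib.Data.Fintype.EquivFin
import Mathlib.Logic.Equiv.Nat

/-!
# [IUTchII] Corollary 4.10 (vi): NON-VACUITY of the interface `ThetaGauChain` — exact inhabitation condition

Mochizuki, *Inter-universal Teichmüller theory II*, §4, Corollary 4.10 (vi), kurims manuscript (Dec. 2020)
p. 161 [claim: Mochizuki2012, status: disputed] (IUTchII §4 Cor 4.10 (vi), kurims p.161): "a collection of
distinct `Θ^{±ell}NF`-Hodge theaters indexed by the integers", giving the infinite chains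
`… ⟶ ⁽ⁿ⁻¹⁾HT ⟶ ⁿHT ⟶ ⁽ⁿ⁺¹⁾HT ⟶ …`. Record-only vocabulary under the claim key `Mochizuki2012` (D-0012,
disputed); abc-iut cell, layer L6, NON-VACUITY CERTIFICATE (L6-lead §F v1.18p «NV-L6 WAVE», row
NV-L6/ThetaGauChain; seat abc-iut-w5-d193) for abc-iut-L6-t2's interface
`Literature.IUT.HodgeArakelov.ThetaGauChain S` (`ThetaGauLinks.lean`, p404606: a `ℤ`-indexed INJECTIVE family
of strip packages `HodgeTheaterStrips S` over a `ThetaLinkSetting`). abc-iut-w5-d114's INHABITATION CENSUS v3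
found NO producer (consumers: `unitMuCoric_chain`, `ThetaGauChain.dLink_full`, the Cor 4.11 chain lemmas).

What the kernel says (proof-only: no `def`, no `instance`, no named fact; witnesses inside the theorem terms):

* `ThetaGauChain.nonempty_iff_infinite` — **the exact inhabitation condition**: over ANY setting `S`,
  `Nonempty (ThetaGauChain S) ↔ Infinite (HodgeTheaterStrips S)` ("distinct … indexed by the integers" is
  exactly an injection `ℤ ↪ HodgeTheaterStrips S`);
* `ThetaGauChain.nonempty_degenerate` — a DEGENERATE witness: all four prime-strip categories := the
  one-object groupoid `SingleObj (Multiplicative ℤ)`, the three functors := identities, every strip := the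
  single object, and the `n`-th theater distinguished by its identification isomorphism `†F^⊩_△ ⥲ †F^⊩_mod :=`
  (the automorphism `n`); HONEST LABEL: degenerate/toy (one-object categories; nothing of the genuine
  `F^⊩`-prime-strip categories of [IUTchI] Def 5.2 / abc-iut-L6-t3's `StripCat` is used);
* `ThetaGauChain.infinite_strips_of_injective` — the general mechanism behind it: any injection from an
  infinite type into the identification isomorphisms `δ ≅ fmod` of ONE strip package yields infinitely many
  distinct packages, hence (with the first item) a chain — so over a genuine setting the interface is
  inhabited as soon as one Hodge theater's `F^⊩_△` has infinitely many automorphisms.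
Nothing here bears on [IUTchIII] Cor. 3.12; no side is taken; a zero row is «not yet witnessed», and a
degenerate witness certifies only the joint satisfiability of the typed laws.
-/

namespace Literature.IUT.HodgeArakelov

open CategoryTheory

universe v₁ v₂ v₃ v₄ u₁ u₂ u₃ u₄

namespace ThetaGauChain

section AnySetting

variable {FV : Type u₁} [Category.{v₁} FV] {FVM : Type u₂} [Category.{v₂} FVM]
  {FUM : Type u₃} [Category.{v₃} FUM] {DM : Type u₄} [Category.{v₄} DM]
  (S : ThetaLinkSetting FV FVM FUM DM)

/-- **Exact inhabitation condition.** A `ℤ`-indexed collection of DISTINCT `Θ^{±ell}NF`-Hodge theaters (through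
their strips) exists iff there are infinitely many distinct strip packages.
[claim: Mochizuki2012, status: disputed] (IUTchII §4 Cor 4.10 (vi), kurims p.161) -/
theorem nonempty_iff_infinite : Nonempty (ThetaGauChain S) ↔ Infinite (HodgeTheaterStrips S) := by
  constructor
  · rintro ⟨P⟩
    exact Infinite.of_injective P.theater P.distinct
  · intro h
    exact ⟨{ theater := fun n => Infinite.natEmbedding (HodgeTheaterStrips S) (Equiv.intEquivNat n)
             distinct := (Infinite.natEmbedding _).injective.comp Equiv.intEquivNat.injective }⟩

/-- **Mechanism.** An injection of an infinite type into the identification isomorphisms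
`†F^⊩_△ ⥲ †F^⊩_mod` of ONE strip package yields infinitely many distinct strip packages (vary that field).
[claim: Mochizuki2012, status: disputed] (IUTchII §4 Cor 4.10 (vi), kurims p.161) -/
theorem infinite_strips_of_injective (T : HodgeTheaterStrips S) {ι : Type*} [Infinite ι]
    (e : ι → (T.delta ≅ T.fmod)) (he : Function.Injective e) : Infinite (HodgeTheaterStrips S) := by
  refine Infinite.of_injective (fun i => ({ T with deltaIsoMod := e i } : HodgeTheaterStrips S)) ?_
  intro i j h
  apply he
  cases T
  simp only [HodgeTheaterStrips.mk.injEq, heq_eq_eq, true_and, and_true] at h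
  exact h

/-- Hence: one strip package with infinitely many identification isomorphisms `†F^⊩_△ ⥲ †F^⊩_mod` gives a
chain. [claim: Mochizuki2012, status: disputed] (IUTchII §4 Cor 4.10 (vi), kurims p.161) -/
theorem nonempty_of_infinite_iso (T : HodgeTheaterStrips S) (h : Infinite (T.delta ≅ T.fmod)) :
    Nonempty (ThetaGauChain S) :=
  (nonempty_iff_infinite S).mpr (infinite_strips_of_injective S T (fun e => e) fun _ _ h => h)

end AnySetting

/-- **NON-VACUITY (DEGENERATE witness).** Over the toy setting whose four prime-strip categories are the
one-object groupoid `SingleObj (Multiplicative ℤ)` and whose three functors are identities, the `n`-th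
theater has every strip equal to the single object and identification isomorphism `†F^⊩_△ ⥲ †F^⊩_mod :=` the
automorphism `n`; these are pairwise distinct, so `ThetaGauChain` is inhabited. degenerate: one-object toy
categories, no genuine prime-strips. [claim: Mochizuki2012, status: disputed] (IUTchII §4 Cor 4.10 (vi), kurims p.161) -/
theorem nonempty_degenerate :
    Nonempty (ThetaGauChain (FV := SingleObj (Multiplicative ℤ)) (FVM := SingleObj (Multiplicative ℤ))
      (FUM := SingleObj (Multiplicative ℤ)) (DM := SingleObj (Multiplicative ℤ))
      { toVdashMu := 𝟭 _, toUnitMu := 𝟭 _, toDMono := 𝟭 _ }) := by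
  refine ⟨{ theater := fun n =>
              { delta := SingleObj.star _
                fmod := SingleObj.star _
                env := SingleObj.star _
                tht := SingleObj.star _
                gau := SingleObj.star _
                deltaIsoMod := (Groupoid.isoEquivHom _ _).symm (Multiplicative.ofAdd n)
                envIsoTht := Iso.refl _
                evalIso := Iso.refl _
                unitDeltaIsoEnv := Iso.refl _
                unitEnvIsoGau := Iso.refl _ },
            distinct := fun n m h => ?_ }⟩
  have h' := congrArg
    (fun T : HodgeTheaterStrips (FV := SingleObj (Multiplicative ℤ)) (FVM := SingleObj (Multiplicative ℤ))
      (FUM := SingleObj (Multiplicative ℤ)) (DM := SingleObj (Multiplicative ℤ))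
      { toVdashMu := 𝟭 _, toUnitMu := 𝟭 _, toDMono := 𝟭 _ } => (T.deltaIsoMod.hom : Multiplicative ℤ)) h
  exact Multiplicative.ofAdd.injective h'

/-- … hence over that toy setting the strip packages are infinite in number (the exact condition, met).
[claim: Mochizuki2012, status: disputed] (IUTchII §4 Cor 4.10 (vi), kurims p.161) -/
theorem infinite_strips_degenerate :
    Infinite (HodgeTheaterStrips (FV := SingleObj (Multiplicative ℤ)) (FVM := SingleObj (Multiplicative ℤ))
      (FUM := SingleObj (Multiplicative ℤ)) (DM := SingleObj (Multiplicative ℤ))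
      { toVdashMu := 𝟭 _, toUnitMu := 𝟭 _, toDMono := 𝟭 _ }) :=
  (nonempty_iff_infinite _).mp nonempty_degenerate

end ThetaGauChain

end Literature.IUT.HodgeArakelov
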